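/-
Copyright (c) 2026 the pub-hodgecm-mathlib formalisation cell (harness21).  Prover seat hodgecm-mathlib-K2E1-p15 (g5) ((V) OF RECORD KEEPER), Track B ∕ K2-LIT, h413 = `stmt-HodgeConjecture-24833`,
R90-TF section S8 «ContSpec-n½», socket B MID :358 «(V) OF RECORD ED. 18» (S8 dealer R90-CS-plan (g4) S8-R273 (1) «ED. 18 = FRAMED-V17 ∘ {`hsrc := hsrc16_of_coreLetters …` + `hm1`}», S8-R295 (1),
S8-R296 (2) «ED. 18 GO»): ★ p865369 `resGMidBlock_ne_bot_of_record_framed_v17`'s frame preamble VERBATIM, then the (V-1) SOURCE LETTER `hsrc` BOUND INSIDE by K2E1-p13 (g6)'s ★ p865365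
`hsrc16_of_coreLetters` at `g₁ := ι_f b₁`, `S₀ := unfoldingBadPlaces hδ h𝔫`, `C := ↑(unfoldingHaarConst …)`, `ε := unfoldingArchPhase ξ` (so `hur hC hε1 hε0 hk` are ★ ∕ in-file), and the
additive Haar data `μE μE₁ μE₂ μF μF₁ μF₂` (free once `hsrc` is internal) CHOSEN inside — the (V-1) head now shows, beyond B's frame, exactly: the unipotent Haar datum `ν 𝓕`, the level
`𝔫 h𝔫 hφ𝔫`, the witness `φ₀`, the arch type `kμ hμ` with the scalar-sub-row binder `hm1` (J-S8-M3′), the CM generator `δ`, the local additive Haar measures `νv`, the unfolding letter `hunfK`,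
the base point `b₁ ∈ K`, and ★ p864821's six LIVE local letters `ω hωc hω1 hωS₀ hΩ hin hsp` (K2E1-p11 (g6)'s ledger f14602fa).
-/
import Summits.HodgeConjecture.HodgeConjecture.Theorems.R90S8ResGMidBlockNeBotOfRecordV17U3      -- ★ p865342 (this seat): (V) OF RECORD ED. 17 `resGMidBlock_ne_bot_of_record_v17` (re-keyed); closure holds ★ p865286's dischargers
import Summits.HodgeConjecture.HodgeConjecture.Theorems.R90S8MidWitnessSrc16OfCoreLettersU3       -- ★ p865365 (K2E1-p13 (g6)): `hsrc16_of_coreLetters` (brings ★ p864821, ★ p864662 `unfoldingHaarConst ∕ unfoldingArchPhase ∕ unfoldingBadPlaces` + their lemmas)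
import Literature.NumberTheory.Automorphic.UnitaryGroupTruncatedKernelIntegrableCM                 -- ★ `complexConj_mul_complexConj` (`c·c = 1`, closed)
import Literature.NumberTheory.Automorphic.AdicCompletionCompact                                -- ★ `locallyCompactSpace_finiteAdeleRing'`, ★ `locallyCompactSpace_adeleRing'`
import HarnessLib

/-!
# S8 socket (V) :358 — `R90S8ResGMidBlockNeBotOfRecordV18U3` ((V) OF RECORD, ED. 18): FRAMED-V17 with `hsrc` BOUND (★ p865365 `hsrc16_of_coreLetters`) — `g₁ S₀ C ε` PINNED to the record,
# `hm1` visible, the additive Haar data chosen inside; visible (L)∕(W) rows: `hunfK`, the six local letters, `hφ𝔫`, `hm1`, witness, `b₁`, `δ`, `νv`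

Track B ∕ K2-LIT, crux h413 = `stmt-HodgeConjecture-24833`, route of record `HCCMUnconditional`; cell `hodgecm-mathlib`, R90-TF section S8 «ContSpec-n½», socket (V)
`sock_S8_res_midBlock_ne_bot` (B :358) — the SCALAR SUB-ROW column (RULING J-S8-M3′: `|m_w| = 1`; the general sub-row is the (V-τ) assembly, K2E1-p14 (g5)).  THEOREMS ONLY (no `def`,
no `instance`, no `notation`, no named-fact hypothesis, no `sorry`; default heartbeats); lane `--supports stmt-HodgeConjecture-24833 --as helper` (count-neutral).  CLOSES NO SOCKET.

THE EDITION (all BY NAME).  (1) ★ p865369's frame preamble :126–:163 VERBATIM (F1′ Borel σ-algebras on `G_∞`, `G_f`, ideles; F3 `νG β μZ hβ hμZ` by ONE `obtain` from ★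
`exists_haar_coveringWeight_unfoldedMeasure_cm_three`; F4′ `ν` right-invariant + `h𝓕₀`; instance preamble; F5–F9 the port Haar measures `μa μf μK νI` + ★ `exists_isIdeleClassDomain`).
(2) NEW FRAME ACTS, free once `hsrc` is internal: Borel σ-algebras on `𝔸_L`, `𝔸_{L⁺}`, `L_∞`, `L⁺_∞`, `𝔸_{L,f}`, `𝔸_{L⁺,f}` (`borel _`, `⟨rfl⟩`) and their additive Haar measures
`μE μF μE₁ μF₁ μE₂ μF₂ := Measure.addHaar` (★ `locallyCompactSpace_adeleRing'`, Mathlib `InfiniteAdeleRing.locallyCompactSpace`, ★ `locallyCompactSpace_finiteAdeleRing'`); F10′ `d hd`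
(`δ² ∈ L⁺`, `rfl`-construction); `hk : kμ,w ≡ 1 [ZMOD 2]` FROM `hm1` (`kμ,w = 2·ξ.eη w ± 1`, `omega`).  (3) THE SOURCE LETTER: `hsrc := hsrc16_of_coreLetters L (complexConj_mul_complexConj L) h2 hc
hcδ hδ hd ν h𝓕N h𝓕c h𝓕1 μE μE₁ μE₂ μF μF₁ μF₂ νv ξ (isUnitary_bcηInv_mul L ξ hμu) hμω hμ hm1 hφ₀V hφ₀c hφ₀M (fun z => eisensteinSeriesU (flatSectionU φ₀ z)) (fun _ _ => rfl) hb₁ 𝔫 h𝔫 hφ𝔫 ω hωc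
hω1 hωS₀ hΩ hin hsp` (★ p865365 = ★ p864821 ∘ ★ p865238 ∘ twisted-CT glue ∘ ★ p865258; the tube continuation `Ec₀` is the Eisenstein series itself, `hEis₀ := rfl`).  (4) `exact
resGMidBlock_ne_bot_of_record_v17 …` (★ p865342) at `S₀ := unfoldingBadPlaces L hδ h𝔫` with `hur := (hgood_unfoldingBadPlaces … hφ𝔫 · ·).2` (★ p864662), `g₁ := ι_f b₁`,
`ε := unfoldingArchPhase L ξ` with `hε1 hε0` ★ `unfoldingArchPhase_norm_le_one ∕ _ne_zero`, `hC` ★ `unfoldingHaarConst_ne_zero` (through `Complex.ofReal_ne_zero`), the CM terms closed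
(`Algebra.IsQuadraticExtension.finrank_eq_two`, `IsCMField.complexConj_ne_one`, written into `hΩ`'s `detChar` and `heisChart` as ★ p865286 did for `hsrc`).
VISIBLE BINDERS (the whole list): B's frame `L μ μω hμu hμω ξ` · the `G(𝔸)` σ-algebra · `ν [IsHaarMeasure] [IsInvInvariant] 𝓕 h𝓕N h𝓕c h𝓕1` · `𝔫 h𝔫 hφ𝔫` (the level of record carries
the conductor of `φ_ξ = ξ.bcη⁻¹·μω`) · `φ₀ hφ₀V hφ₀c hφ₀M` (J-S8-WIT′) · `kμ hμ hm1` (arch type of `μω`; SCALAR SUB-ROW) · `δ hcδ hδ` · adic σ-algebras + `νv [IsAddHaar]` · `hunfK` at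
`S₀ := unfoldingBadPlaces hδ h𝔫` (payer ★ p864886 `hunfK_of_core` ∘ (W)-core readings ∕ F0P2-p11 ★ p865363 set change + W1 2∕2) · `b₁ hb₁` · `ω hωc hω1 hωS₀ hΩ hin hsp` (★ p864821's LOCAL
letters, K2E1-p11 (g6): (d1) ★ p865317 split reading, (d2) `hsp`, base-point element, ω-definition edition `hsrc_letterFree_at_basePoint` ⇒ K2E1-p13's `hsrc16_letterFree` ⇒ ED. 19 drops all
seven).  GONE vs FRAMED-V17: `S₀ hur g₁ ε hε1 hε0 hk C hC hsrc μE₁ μF₁` + the two `InfiniteAdeleRing` σ-algebra pairs; NEW: `hφ𝔫 hμ hm1 b₁ hb₁ ω hωc hω1 hωS₀ hΩ hin hsp` (`kμ` implicit).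
* **`resGMidBlock_ne_bot_of_record_v18`** — `LHalfNeZero (ξ.bcη⁻¹ * μω) → resGMidBlock L μ ξ μω ≠ ⊥` from the list above.
HONEST LABEL: HC_CM is proved only modulo the 7 printed citations (2 remaining named inputs: hLiu418 = `stmt-HodgeConjecture-24832`, h413 = `stmt-HodgeConjecture-24833`) until
rung 0 closes; OF-RECORD ≠ payment — :358 stays `sorry` in B until `hunfK`, the six local letters, the witness block (`𝔫 h𝔫 hφ𝔫 φ₀ … b₁ hb₁`), `hm1`'s sub-row split and the frame are
instantiated from the socket's 11 binders; (V) = scalar sub-row only; SOCKET DIGITS 0∕8; REL ≠ ★ ≠ WRITTEN ≠ BUILT; count-neutral.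

## References
* [Rogawski1990] J. D. Rogawski, *Automorphic Representations of Unitary Groups in Three Variables* (1990), §12.2 p. 174, §13.9 (ii) p. 229, §14.2 p. 232.
* [MoeglinWaldspurger1995] C. Mœglin, J.-L. Waldspurger, *Spectral Decomposition and Eisenstein Series* (1995), II.1.6–II.1.7, IV.1.11, IV.2.3.
* [TateThesis1967] J. Tate, *Fourier analysis in number fields and Hecke's zeta-functions* (1967), Thm 3.3.1.
* [WeilIntegration1965] A. Weil, *L'intégration dans les groupes topologiques et ses applications* (2ᵉ éd., 1965), §9.
-/


set_option autoImplicit false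
set_option linter.dupNamespace false  -- the mandated namespace `…HodgeConjecture.HodgeConjecture.R90.S8` (LEAD #1 L1) repeats the summit's segment

noncomputable section

open MeasureTheory Measure NumberField IsDedekindDomain Set Filter Topology Metric
open scoped ENNReal NNReal MatrixGroups
open Literature.MeasureTheory.Group Literature.NumberTheory
open Literature.NumberTheory.Automorphic Literature.NumberTheory.Automorphic.UnitaryGroup Literature.NumberTheory.LFunctions Literature.NumberTheory.GaloisRepresentations AdelicGroupData
open Literature.NumberTheory.Automorphic.Arthur2013.Leaves.TECR Literature.NumberTheory.Rogawski1990 ContRepresentation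
open Summit.HodgeConjecture.HodgeConjecture.Cruxes.H413.K2E1BorelEisensteinU
open Summit.HodgeConjecture.HodgeConjecture.Cruxes.H413.K2E1BLBorelSpacesU2Defs
open Summit.HodgeConjecture.HodgeConjecture.Cruxes.H413.K2E1BLBorelOperatorsU2Defs
open Summit.HodgeConjecture.HodgeConjecture.Cruxes.H413.K2E1CharacterEisensteinU2Defs
open Summit.HodgeConjecture.HodgeConjecture.Cruxes.H413.K2E1ChiSectionSpaceU2Defs
open Summit.HodgeConjecture.HodgeConjecture.Cruxes.H413.K2E1CharacterEisensteinU3PairDefs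
open Summit.HodgeConjecture.HodgeConjecture.Cruxes.H413.K2E1ChiSectionSpaceU3PairDefs
open Summit.HodgeConjecture.HodgeConjecture.Cruxes.H413.K2E1HeckeLHalfNeZeroDefs (LHalfNeZero)
open Summit.HodgeConjecture.HodgeConjecture.Cruxes.H413.K2E1SphericalEisensteinStructuralDataCMThree (exists_haar_coveringWeight_unfoldedMeasure_cm_three)
open Literature.NumberTheory.GaloisRepresentations.IsNonarchimedeanLocalField
open Literature.NumberTheory.Automorphic.UnitaryGroup.AdelicCharactersDetQuasiSplit (antidiagonal_over_det_ne_zero)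
open scoped ComplexConjugate
open Summit.HodgeConjecture.HodgeConjecture.Cruxes.H413.K2E1ChiUnfoldingConstantsOfRecordU3 (unfoldingHaarConst unfoldingArchPhase unfoldingBadPlaces hgood_unfoldingBadPlaces unfoldingHaarConst_ne_zero unfoldingArchPhase_norm_le_one unfoldingArchPhase_ne_zero)
open Summit.HodgeConjecture.HodgeConjecture.Cruxes.H413.K2E1ChiMidBlockUnfoldingOfRecordU3 (isUnitary_quadraticHeckeCharCM_mul_self bcηInv_mul_ideleBaseChange_eq)


namespace Summit.HodgeConjecture.HodgeConjecture.R90.S8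

variable (L : Type) [Field L] [NumberField L] [IsCMField L]
  [MeasurableSpace (quasiSplit (↥(maximalRealSubfield L)) L (IsCMField.complexConj L) 3).Adelic] [BorelSpace (quasiSplit (↥(maximalRealSubfield L)) L (IsCMField.complexConj L) 3).Adelic]

/-- **(V) OF RECORD, ED. 18 — `LHalfNeZero (ξ.bcη⁻¹·μω) → resGMidBlock L μ ξ μω ≠ ⊥`** from: B's frame; the unipotent Haar datum `ν 𝓕 h𝓕N h𝓕c h𝓕1`; the level `𝔫 h𝔫` carrying the conductor
of `φ_ξ` (`hφ𝔫`); the witness `φ₀ hφ₀V hφ₀c hφ₀M`; the arch type `kμ hμ` IN THE SCALAR SUB-ROW `hm1 : kμ,w − 2·ξ.eη w = ±1`; the CM generator `δ`; the adic additive Haar measures `νv`; the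
unfolding letter `hunfK` at `S₀ := unfoldingBadPlaces hδ h𝔫`; the base point `ι_f b₁ ∈ K`; ★ p864821's six local letters `ω hωc hω1 hωS₀ hΩ hin hsp`.  Proof: ★ p865369's frame preamble, the
additive Haar data chosen, `hsrc := hsrc16_of_coreLetters …` (★ p865365), `exact resGMidBlock_ne_bot_of_record_v17 …` (★ p865342). [cite: Rogawski1990, §13.9 (ii) p. 229]
[cite: MoeglinWaldspurger1995, II.1.7, IV.1.11] [cite: TateThesis1967, Thm 3.3.1] [cite: WeilIntegration1965, §9] -/
theorem resGMidBlock_ne_bot_of_record_v18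
    (μ : Measure (quasiSplit (↥(maximalRealSubfield L)) L (IsCMField.complexConj L) 3).automorphicQuotient) [(quasiSplit (↥(maximalRealSubfield L)) L (IsCMField.complexConj L) 3).IsAutomorphicMeasure μ]
    (μω : HeckeCharacter L) (hμu : μω.IsUnitary)
    (hμω : ∀ x : ideleGroup ↥(maximalRealSubfield L), μω (AdeleRing.ideleBaseChange (↥(maximalRealSubfield L)) L x) = quadraticHeckeCharCM L x)
    (ξ : OneDimAutRepH L)
    (ν : Measure ↥(adelicUnipotent (↥(maximalRealSubfield L)) L (IsCMField.complexConj L) 3)) [ν.IsHaarMeasure] [ν.IsInvInvariant]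
    {𝓕 : Set ↥(adelicUnipotent (↥(maximalRealSubfield L)) L (IsCMField.complexConj L) 3)}
    (h𝓕N : IsFundamentalDomain ↥(rationalUnipotent (↥(maximalRealSubfield L)) L (IsCMField.complexConj L) 3) 𝓕 ν) (h𝓕c : IsCompact (closure 𝓕)) (h𝓕1 : ν 𝓕 = 1)
    -- (i) THE LEVEL OF RECORD `K(𝔫)` BY NAME, `𝔫 ≠ 0` (K2E1-p11 ★ p863976 ∕ p864091 ∕ p864141; `K_f := finCongruenceLevel 𝔫`, `U₀ := K_f(𝔫) ≤ GL₃(𝔸_f)` open compact ★ Ash–Smith): `K′ := levelOfRecord K(𝔫)_f`, `ω₀ := omegaOfRecord χ 1 K(𝔫)_f`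
    (𝔫 : Ideal (𝓞 L)) (h𝔫 : 𝔫 ≠ 0)
    -- (W) ED. 18: the level of record carries the conductor of `φ_ξ = ξ.bcη⁻¹·μω` (★ `hgood_unfoldingBadPlaces`'s hypothesis; `hur` of ED. 17 and ★ p864821's `hgood` discharged from it at `S₀ := unfoldingBadPlaces hδ h𝔫`)
    (hφ𝔫 : ∀ w : HeightOneSpectrum (𝓞 L), ¬ (ξ.bcη⁻¹ * μω).IsUnramifiedAt w → w.asIdeal ∣ 𝔫)
    -- (i) THE WITNESS AS BINDERS (J-S8-WIT′): `φ₀ ∈ V(ξ.bcη⁻¹·μω; levelOfRecord K_f, omegaOfRecord … 1 K_f)`, continuous, `‖φ₀‖ ≤ 1` (`Mφ := 1`)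
    {φ₀ : (quasiSplit (↥(maximalRealSubfield L)) L (IsCMField.complexConj L) 3).Adelic → ℂ} (hφ₀V : φ₀ ∈ chiSectionSpace (ξ.bcη⁻¹ * μω) (levelOfRecord L (finCongruenceLevel (↥(maximalRealSubfield L)) L (IsCMField.complexConj L) 3 ((StdForm.antidiagonal 3).over L) 𝔫)) (omegaOfRecord L (ξ.bcη⁻¹ * μω) (1 : ↥(TorusDict.torus (IsCMField.complexConj L)) →ₜ* ℂˣ) (finCongruenceLevel (↥(maximalRealSubfield L)) L (IsCMField.complexConj L) 3 ((StdForm.antidiagonal 3).over L) 𝔫))) (hφ₀c : Continuous φ₀) (hφ₀M : ∀ x, ‖φ₀ x‖ ≤ 1)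
    -- (W) ED. 18: the unitary archimedean type `(kμ, 0)` of `μω` (J-S8-M3′ (a): intrinsic to the socket's `μω`; `hk` oddness now follows from `hm1`) and THE SCALAR SUB-ROW `|m_w| = 1` (J-S8-M3′ (b), `hm1`; consumed by ★ p865365)
    {kμ : InfinitePlace L → ℤ} (hμ : μω.HasUnitaryArchType kμ 0) (hm1 : ∀ w, kμ w - 2 * ξ.eη w = 1 ∨ kμ w - 2 * ξ.eη w = -1)
    -- the CM generator `δ` (in the local letters' boxes) and the adic additive Haar measures (in `hin hsp`)
    {δ : L} (hcδ : IsCMField.complexConj L δ = -δ) (hδ : δ ≠ 0)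
    [∀ v : HeightOneSpectrum (𝓞 ↥(maximalRealSubfield L)), MeasurableSpace (v.adicCompletion ↥(maximalRealSubfield L))] [∀ v : HeightOneSpectrum (𝓞 ↥(maximalRealSubfield L)), BorelSpace (v.adicCompletion ↥(maximalRealSubfield L))]
    (νv : ∀ v : HeightOneSpectrum (𝓞 ↥(maximalRealSubfield L)), Measure (v.adicCompletion ↥(maximalRealSubfield L))) [∀ v, (νv v).IsAddHaarMeasure]
    -- (L) THE ONE UNFOLDING LETTER `hunfK` (K2E2-p12 (g10)'s bytes) AT `S₀ := unfoldingBadPlaces hδ h𝔫` — payer ★ p864886 `hunfK_of_core` ∘ the (W)-core's readings (same currency since ED. 17)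
    (hunfK : ∀ k : (quasiSplit (↥(maximalRealSubfield L)) L (IsCMField.complexConj L) 3).Adelic, adelicVal (↥(maximalRealSubfield L)) L (IsCMField.complexConj L) 3 ((StdForm.antidiagonal 3).over L) k ∈ standardMaximalCompactGL 3 L →
      ∃ A : ℂ → ℂ, DifferentiableOn ℂ A {z : ℂ | 1 < z.re} ∧ ∀ z : ℂ, 2 < z.re →
        (∫ v : ↥(adelicUnipotent (↥(maximalRealSubfield L)) L (IsCMField.complexConj L) 3), flatSectionU φ₀ z (((quasiSplit (↥(maximalRealSubfield L)) L (IsCMField.complexConj L) 3).toAdelic (weylLongU ((IsCMField.complexConj L : L ≃ₐ[↥(maximalRealSubfield L)] L) : L →+* L) (rfl : (StdForm.antidiagonal 3).over L = (StdForm.antidiagonal 3).over L))) * ((v : (quasiSplit (↥(maximalRealSubfield L)) L (IsCMField.complexConj L) 3).Adelic) * k)) ∂ν) =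
          ((partialStandardL {w : HeightOneSpectrum (𝓞 L) | w.under (𝓞 ↥(maximalRealSubfield L)) ∈ (↑(unfoldingBadPlaces L hδ h𝔫) : Set (HeightOneSpectrum (𝓞 ↥(maximalRealSubfield L))))} (fun w => {(ξ.bcη⁻¹ * μω).valueAtUniformizer w}) (z - 1) * partialStandardL (↑(unfoldingBadPlaces L hδ h𝔫) : Set (HeightOneSpectrum (𝓞 ↥(maximalRealSubfield L)))) (fun v => {(1 : HeckeCharacter ↥(maximalRealSubfield L)).valueAtUniformizer v}) (2 * z - 2)) /
            (partialStandardL {w : HeightOneSpectrum (𝓞 L) | w.under (𝓞 ↥(maximalRealSubfield L)) ∈ (↑(unfoldingBadPlaces L hδ h𝔫) : Set (HeightOneSpectrum (𝓞 ↥(maximalRealSubfield L))))} (fun w => {(ξ.bcη⁻¹ * μω).valueAtUniformizer w}) z * partialStandardL (↑(unfoldingBadPlaces L hδ h𝔫) : Set (HeightOneSpectrum (𝓞 ↥(maximalRealSubfield L)))) (fun v => {(1 : HeckeCharacter ↥(maximalRealSubfield L)).valueAtUniformizer v}) (2 * z - 1))) * A z)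
    -- (W) the FINITE BASE POINT `ι_f b₁ ∈ K` (`g₁ := ι_f b₁`; K2E1-p11 (g6)'s base-point element `ι_f(w₀^{S₀})`)
    {b₁ : ↥(finAdelic (↥(maximalRealSubfield L)) L (IsCMField.complexConj L) 3 ((StdForm.antidiagonal 3).over L))} (hb₁ : finAdelicToAdelic (↥(maximalRealSubfield L)) L (IsCMField.complexConj L) 3 ((StdForm.antidiagonal 3).over L) b₁ ∈ ((standardMaximalCompactGL 3 L).comap (adelicVal (↥(maximalRealSubfield L)) L (IsCMField.complexConj L) 3 ((StdForm.antidiagonal 3).over L)) : Subgroup (quasiSplit (↥(maximalRealSubfield L)) L (IsCMField.complexConj L) 3).Adelic))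
    -- (L) ★ p864821's SIX LOCAL LETTERS at `S₀ := unfoldingBadPlaces hδ h𝔫` on ONE weight binder `ω` (K2E1-p11 (g6)'s ledger f14602fa: `hΩ` (d1) ★ p865317-readings, `hsp` (d2), `hω1`, `hωc`, `hin`, STRUCT `hωS₀`) — ★ p865365's binders VERBATIM (CM terms closed)
    (ω : ∀ v : HeightOneSpectrum (𝓞 ↥(maximalRealSubfield L)), (Fin 3 → v.adicCompletion ↥(maximalRealSubfield L)) → ℂ)
    (hωc : ∀ z : ℂ, 2 < z.re → ∀ v, Continuous fun p : Fin 3 → v.adicCompletion ↥(maximalRealSubfield L) =>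
        ω v p * (((∏ w' : PlacesOver L v, max 1 (max ((normAbs (w'.1.adicCompletion L) (quadraticLocalEquiv L v (IsCMField.complexConj L) hcδ hδ (p 0, p 1) w') : ℝ≥0) : ℝ)
            ((normAbs (w'.1.adicCompletion L) ((toLocalRing L v (p 2) * algebraMap L (LocalRing L v) δ -
              toLocalRing L v 2⁻¹ * (quadraticLocalEquiv L v (IsCMField.complexConj L) hcδ hδ (p 0, p 1) *
                conjLocal L (IsCMField.complexConj L) v (quadraticLocalEquiv L v (IsCMField.complexConj L) hcδ hδ (p 0, p 1)))) w') : ℝ≥0) : ℝ))) : ℝ) : ℂ) ^ (-z))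
    (hω1 : ∀ v ∉ (unfoldingBadPlaces L hδ h𝔫), ∀ p ∈ integralBox ↥(maximalRealSubfield L) (Fin 3) v, ω v p = 1)
    (hωS₀ : ∀ v ∈ (unfoldingBadPlaces L hδ h𝔫), ω v = Set.indicator {p : Fin 3 → v.adicCompletion ↥(maximalRealSubfield L) | p ∈ integralBox ↥(maximalRealSubfield L) (Fin 3) v ∧ ∀ w' : PlacesOver L v,
              Valued.v (quadraticLocalEquiv L v (IsCMField.complexConj L) hcδ hδ (p 0, p 1) w') ≤ idealRadius L w'.1 𝔫 ∧
              Valued.v (conjLocal L (IsCMField.complexConj L) v (quadraticLocalEquiv L v (IsCMField.complexConj L) hcδ hδ (p 0, p 1)) w') ≤ idealRadius L w'.1 𝔫 ∧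
              Valued.v ((toLocalRing L v (p 2) * algebraMap L (LocalRing L v) δ -
                toLocalRing L v 2⁻¹ * (quadraticLocalEquiv L v (IsCMField.complexConj L) hcδ hδ (p 0, p 1) * conjLocal L (IsCMField.complexConj L) v (quadraticLocalEquiv L v (IsCMField.complexConj L) hcδ hδ (p 0, p 1)))) w') ≤ idealRadius L w'.1 𝔫}
            (fun _ => (1 : ℂ)))
    (hΩ : ∀ x : Fin 3 → FiniteAdeleRing (𝓞 ↥(maximalRealSubfield L)) ↥(maximalRealSubfield L),
      φ₀ (finAdelicToAdelic (↥(maximalRealSubfield L)) L (IsCMField.complexConj L) 3 ((StdForm.antidiagonal 3).over L) (finPart (↥(maximalRealSubfield L)) L (IsCMField.complexConj L) 3 ((StdForm.antidiagonal 3).over L) ((quasiSplit (↥(maximalRealSubfield L)) L (IsCMField.complexConj L) 3).toAdelic (weylLongU ((IsCMField.complexConj L : L ≃ₐ[↥(maximalRealSubfield L)] L) : L →+* L) (rfl : (StdForm.antidiagonal 3).over L = (StdForm.antidiagonal 3).over L)) * (((heisChart (complexConj_mul_complexConj L) (((((0 : InfiniteAdeleRing L)), quadraticFiniteAdeleMap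 ↥(maximalRealSubfield L) L δ (x 0, x 1)) : AdeleRing (𝓞 L) L), traceZeroLine ↥(maximalRealSubfield L) L (IsCMField.complexConj L) hcδ hδ ((0, x 2) : AdeleRing (𝓞 ↥(maximalRealSubfield L)) ↥(maximalRealSubfield L)))) : ↥(adelicUnipotent ↥(maximalRealSubfield L) L (IsCMField.complexConj L) 3)) : (quasiSplit (↥(maximalRealSubfield L)) L (IsCMField.complexConj L) 3).Adelic)) * b₁)) *
        (((detChar (↥(maximalRealSubfield L)) L (IsCMField.complexConj L) (Algebra.IsQuadraticExtension.finrank_eq_two (↥(maximalRealSubfield L)) L) (IsCMField.complexConj_ne_one L) 3 ((StdForm.antidiagonal 3).over L) ξ.ψ ξ.hψ (antidiagonal_over_det_ne_zero L 3)) (finAdelicToAdelic (↥(maximalRealSubfield L)) L (IsCMField.complexConj L) 3 ((StdForm.antidiagonal 3).over L) (finPart (↥(maximalRealSubfield L)) L (IsCMField.complexConj L) 3 ((StdForm.antidiagonal 3).over L) ((quasiSplit (↥(maximalRealSubfield L)) L (IsCMField.complexConj L) 3).toAdelic (weylLongU ((IsCMField.complexConj L : L ≃ₐ[↥(maximalRealSubfield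 L)] L) : L →+* L) (rfl : (StdForm.antidiagonal 3).over L = (StdForm.antidiagonal 3).over L)) * (((heisChart (complexConj_mul_complexConj L) (((((0 : InfiniteAdeleRing L)), quadraticFiniteAdeleMap ↥(maximalRealSubfield L) L δ (x 0, x 1)) : AdeleRing (𝓞 L) L), traceZeroLine ↥(maximalRealSubfield L) L (IsCMField.complexConj L) hcδ hδ ((0, x 2) : AdeleRing (𝓞 ↥(maximalRealSubfield L)) ↥(maximalRealSubfield L)))) : ↥(adelicUnipotent ↥(maximalRealSubfield L) L (IsCMField.complexConj L) 3)) : (quasiSplit (↥(maximalRealSubfield L)) L (IsCMField.complexConj L) 3).Adelic)) * b₁)) : ℂˣ) : ℂ) = ∏ᶠ v : HeightOneSpectrum (𝓞 ↥(maximalRealSubfield L)), ω v (fun i => x i v))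
    (hin : ∀ z : ℂ, 2 < z.re → ∀ v ∉ (unfoldingBadPlaces L hδ h𝔫), ∀ w : PlacesOver L v, IsCMField.complexConj L • w.1 = w.1 →
        ((Measure.pi fun _ : Fin 3 => νv v) (integralBox ↥(maximalRealSubfield L) (Fin 3) v)).toReal⁻¹ •
            ∫ p : Fin 3 → v.adicCompletion ↥(maximalRealSubfield L),
              ω v p * (((∏ w' : PlacesOver L v, max 1 (max ((normAbs (w'.1.adicCompletion L) (quadraticLocalEquiv L v (IsCMField.complexConj L) hcδ hδ (p 0, p 1) w') : ℝ≥0) : ℝ)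
                ((normAbs (w'.1.adicCompletion L) ((toLocalRing L v (p 2) * algebraMap L (LocalRing L v) δ -
                  toLocalRing L v 2⁻¹ * (quadraticLocalEquiv L v (IsCMField.complexConj L) hcδ hδ (p 0, p 1) *
                    conjLocal L (IsCMField.complexConj L) v (quadraticLocalEquiv L v (IsCMField.complexConj L) hcδ hδ (p 0, p 1)))) w') : ℝ≥0) : ℝ))) : ℝ) : ℂ) ^ (-z)
              ∂(Measure.pi fun _ : Fin 3 => νv v) =
          (1 - (ξ.bcη⁻¹ * μω).valueAtUniformizer w.1 * (v.residueCard : ℂ) ^ (-(2 * z))) * (1 + (ξ.bcη⁻¹ * μω).valueAtUniformizer w.1 * (v.residueCard : ℂ) ^ (-(2 * z - 1))) /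
            ((1 - (ξ.bcη⁻¹ * μω).valueAtUniformizer w.1 * (v.residueCard : ℂ) ^ (-(2 * z - 2))) * (1 + (ξ.bcη⁻¹ * μω).valueAtUniformizer w.1 * (v.residueCard : ℂ) ^ (-(2 * z - 2)))))
    (hsp : ∀ z : ℂ, 2 < z.re → ∀ v ∉ (unfoldingBadPlaces L hδ h𝔫), ∀ w : PlacesOver L v, IsCMField.complexConj L • w.1 ≠ w.1 →
        ((Measure.pi fun _ : Fin 3 => νv v) (integralBox ↥(maximalRealSubfield L) (Fin 3) v)).toReal⁻¹ •
            ∫ p : Fin 3 → v.adicCompletion ↥(maximalRealSubfield L),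
              ω v p * (((∏ w' : PlacesOver L v, max 1 (max ((normAbs (w'.1.adicCompletion L) (quadraticLocalEquiv L v (IsCMField.complexConj L) hcδ hδ (p 0, p 1) w') : ℝ≥0) : ℝ)
                ((normAbs (w'.1.adicCompletion L) ((toLocalRing L v (p 2) * algebraMap L (LocalRing L v) δ -
                  toLocalRing L v 2⁻¹ * (quadraticLocalEquiv L v (IsCMField.complexConj L) hcδ hδ (p 0, p 1) *
                    conjLocal L (IsCMField.complexConj L) v (quadraticLocalEquiv L v (IsCMField.complexConj L) hcδ hδ (p 0, p 1)))) w') : ℝ≥0) : ℝ))) : ℝ) : ℂ) ^ (-z)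
              ∂(Measure.pi fun _ : Fin 3 => νv v) =
          (1 - (ξ.bcη⁻¹ * μω).valueAtUniformizer w.1 * (v.residueCard : ℂ) ^ (-z)) * (1 - (ξ.bcη⁻¹ * μω).valueAtUniformizer (PlacesOver.galInv (IsCMField.complexConj L) w).1 * (v.residueCard : ℂ) ^ (-z)) *
              (1 - (ξ.bcη⁻¹ * μω).valueAtUniformizer w.1 * (ξ.bcη⁻¹ * μω).valueAtUniformizer (PlacesOver.galInv (IsCMField.complexConj L) w).1 * (v.residueCard : ℂ) ^ (-(2 * z - 1))) /
            ((1 - (ξ.bcη⁻¹ * μω).valueAtUniformizer w.1 * (v.residueCard : ℂ) ^ (-(z - 1))) * (1 - (ξ.bcη⁻¹ * μω).valueAtUniformizer (PlacesOver.galInv (IsCMField.complexConj L) w).1 * (v.residueCard : ℂ) ^ (-(z - 1))) *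
              (1 - (ξ.bcη⁻¹ * μω).valueAtUniformizer w.1 * (ξ.bcη⁻¹ * μω).valueAtUniformizer (PlacesOver.galInv (IsCMField.complexConj L) w).1 * (v.residueCard : ℂ) ^ (-(2 * z - 2))))) :
    LHalfNeZero (ξ.bcη⁻¹ * μω) → resGMidBlock L μ ξ μω ≠ ⊥ := by
  -- F1′: Borel σ-algebras on `G_∞`, `G_f` and the ideles
  letI : MeasurableSpace ↥(arch (↥(maximalRealSubfield L)) L (IsCMField.complexConj L) 3 ((StdForm.antidiagonal 3).over L)) := borel _
  haveI : BorelSpace ↥(arch (↥(maximalRealSubfield L)) L (IsCMField.complexConj L) 3 ((StdForm.antidiagonal 3).over L)) := ⟨rfl⟩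
  letI : MeasurableSpace ↥(finAdelic (↥(maximalRealSubfield L)) L (IsCMField.complexConj L) 3 ((StdForm.antidiagonal 3).over L)) := borel _
  haveI : BorelSpace ↥(finAdelic (↥(maximalRealSubfield L)) L (IsCMField.complexConj L) 3 ((StdForm.antidiagonal 3).over L)) := ⟨rfl⟩
  letI : MeasurableSpace (AdeleRing (𝓞 L) L)ˣ := borel _
  haveI : BorelSpace (AdeleRing (𝓞 L) L)ˣ := ⟨rfl⟩
  -- F3: the `G`-side structural cluster `νG β μZ` (★ one-shot package)
  obtain ⟨νG, β, μZ, hH, -, hI, hS, hβ, hSZ, hμZ⟩ := exists_haar_coveringWeight_unfoldedMeasure_cm_three L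
  haveI := hH
  haveI := hI
  haveI := hS
  haveI := hSZ
  -- F4′: `ν` is right-invariant (Haar + inversion-invariant); `ν 𝓕 ≠ 0`
  haveI : ν.IsMulRightInvariant := by
    have h := Measure.inv.instIsMulRightInvariant (μ := ν)
    rwa [Measure.inv_eq_self] at h
  have h𝓕₀ : ν 𝓕 ≠ 0 := by
    rw [h𝓕1]
    exact one_ne_zero
  -- instance preamble for the Haar choices
  haveI := t2Space_adeleRing_of_numberField L
  haveI := locallyCompactSpace_adeleRing' L
  haveI : T2Space (quasiSplit (↥(maximalRealSubfield L)) L (IsCMField.complexConj L) 3).Adelic :=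
    inferInstanceAs (T2Space (adelic (↥(maximalRealSubfield L)) L (IsCMField.complexConj L) 3 ((StdForm.antidiagonal 3).over L)))
  haveI : LocallyCompactSpace ↥(finAdelic (↥(maximalRealSubfield L)) L (IsCMField.complexConj L) 3 ((StdForm.antidiagonal 3).over L)) :=
    locallyCompactSpace_finAdelic (↥(maximalRealSubfield L)) L (IsCMField.complexConj L) 3 ((StdForm.antidiagonal 3).over L)
  haveI : CompactSpace ↥((standardMaximalCompactGL 3 L).comap (adelicVal (↥(maximalRealSubfield L)) L (IsCMField.complexConj L) 3 ((StdForm.antidiagonal 3).over L)) :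
      Subgroup (quasiSplit (↥(maximalRealSubfield L)) L (IsCMField.complexConj L) 3).Adelic) := isCompact_iff_compactSpace.1 isCompact_comap_adelicVal_standardMaximalCompactGL
  haveI := locallyCompactSpace_ideleGroup L
  -- F5 F6 F8 F9: the port Haar measures and the idele class domain
  set μa : Measure ↥(arch (↥(maximalRealSubfield L)) L (IsCMField.complexConj L) 3 ((StdForm.antidiagonal 3).over L)) := Measure.haar with hμa
  haveI : μa.IsMulRightInvariant :=
    isMulRightInvariant_of_modularCharacterFun_eq_one (modularCharacterFun_arch_eq_one L ((StdForm.antidiagonal 3).over L) (cmConj_antidiagonal_transpose L (N := 3)) (isUnit_det_antidiagonal_over L (N := 3)).ne_zero) μa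
  set μf : Measure ↥(finAdelic (↥(maximalRealSubfield L)) L (IsCMField.complexConj L) 3 ((StdForm.antidiagonal 3).over L)) := Measure.haar with hμf
  set μK : Measure ↥((standardMaximalCompactGL 3 L).comap (adelicVal (↥(maximalRealSubfield L)) L (IsCMField.complexConj L) 3 ((StdForm.antidiagonal 3).over L)) :
      Subgroup (quasiSplit (↥(maximalRealSubfield L)) L (IsCMField.complexConj L) 3).Adelic) := Measure.haar with hμK
  set νI : Measure (AdeleRing (𝓞 L) L)ˣ := Measure.haar with hνI
  obtain ⟨𝓕I, h𝓕I⟩ := exists_isIdeleClassDomain L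
  -- ED. 18 F′: Borel σ-algebras and additive Haar measures on `𝔸_L`, `𝔸_{L⁺}`, `L_∞`, `L⁺_∞`, `𝔸_{L,f}`, `𝔸_{L⁺,f}` (free once `hsrc` is internal: they only enter ★ p864662's `unfoldingHaarConst`)
  letI : MeasurableSpace (AdeleRing (𝓞 L) L) := borel _
  haveI : BorelSpace (AdeleRing (𝓞 L) L) := ⟨rfl⟩
  letI : MeasurableSpace (AdeleRing (𝓞 ↥(maximalRealSubfield L)) ↥(maximalRealSubfield L)) := borel _
  haveI : BorelSpace (AdeleRing (𝓞 ↥(maximalRealSubfield L)) ↥(maximalRealSubfield L)) := ⟨rfl⟩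
  letI : MeasurableSpace (InfiniteAdeleRing L) := borel _
  haveI : BorelSpace (InfiniteAdeleRing L) := ⟨rfl⟩
  letI : MeasurableSpace (InfiniteAdeleRing ↥(maximalRealSubfield L)) := borel _
  haveI : BorelSpace (InfiniteAdeleRing ↥(maximalRealSubfield L)) := ⟨rfl⟩
  letI : MeasurableSpace (FiniteAdeleRing (𝓞 L) L) := borel _
  haveI : BorelSpace (FiniteAdeleRing (𝓞 L) L) := ⟨rfl⟩
  letI : MeasurableSpace (FiniteAdeleRing (𝓞 ↥(maximalRealSubfield L)) ↥(maximalRealSubfield L)) := borel _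
  haveI : BorelSpace (FiniteAdeleRing (𝓞 ↥(maximalRealSubfield L)) ↥(maximalRealSubfield L)) := ⟨rfl⟩
  haveI := t2Space_adeleRing_of_numberField ↥(maximalRealSubfield L)
  haveI := locallyCompactSpace_adeleRing' ↥(maximalRealSubfield L)
  haveI := locallyCompactSpace_finiteAdeleRing' L
  haveI := locallyCompactSpace_finiteAdeleRing' ↥(maximalRealSubfield L)
  set μE : Measure (AdeleRing (𝓞 L) L) := Measure.addHaar with hμE
  set μF : Measure (AdeleRing (𝓞 ↥(maximalRealSubfield L)) ↥(maximalRealSubfield L)) := Measure.addHaar with hμF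
  set μE₁ : Measure (InfiniteAdeleRing L) := Measure.addHaar with hμE₁
  set μF₁ : Measure (InfiniteAdeleRing ↥(maximalRealSubfield L)) := Measure.addHaar with hμF₁
  set μE₂ : Measure (FiniteAdeleRing (𝓞 L) L) := Measure.addHaar with hμE₂
  set μF₂ : Measure (FiniteAdeleRing (𝓞 ↥(maximalRealSubfield L)) ↥(maximalRealSubfield L)) := Measure.addHaar with hμF₂
  -- F10′: `δ² ∈ L⁺`
  have hd : δ * δ = algebraMap ↥(maximalRealSubfield L) L ⟨δ * δ, (IsCMField.complexConj_eq_self_iff L _).1 (by rw [map_mul, hcδ, neg_mul_neg])⟩ := rfl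
  -- `kμ` is odd: `kμ,w = 2·ξ.eη w ± 1` (`hm1`)
  have hk : ∀ w, Int.ModEq 2 (kμ w) 1 := fun w => by
    rcases hm1 w with h | h <;> (unfold Int.ModEq; omega)
  -- (V-1) THE SOURCE LETTER, BOUND: ★ p865365 `hsrc16_of_coreLetters` (tube continuation := the Eisenstein series itself)
  have hsrc := hsrc16_of_coreLetters L (complexConj_mul_complexConj L) (Algebra.IsQuadraticExtension.finrank_eq_two (↥(maximalRealSubfield L)) L) (IsCMField.complexConj_ne_one L) hcδ hδ hd
    ν h𝓕N h𝓕c h𝓕1 μE μE₁ μE₂ μF μF₁ μF₂ νv ξ (isUnitary_bcηInv_mul L ξ hμu) hμω hμ hm1 hφ₀V hφ₀c hφ₀M (fun z => eisensteinSeriesU (flatSectionU φ₀ z)) (fun _ _ => rfl) hb₁ 𝔫 h𝔫 hφ𝔫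
    ω hωc hω1 hωS₀ hΩ hin hsp
  -- ED. 17 (★ p865342) at `S₀ := unfoldingBadPlaces hδ h𝔫`, `hur` from ★ `hgood_unfoldingBadPlaces`, `g₁ := ι_f b₁`, `ε := unfoldingArchPhase ξ`, `C := ↑(unfoldingHaarConst …)`, with the closed CM terms
  exact resGMidBlock_ne_bot_of_record_v17 L μ μω hμu hμω ξ νG ν h𝓕N h𝓕c h𝓕₀ hβ hμZ μa μf
    (Algebra.IsQuadraticExtension.finrank_eq_two (↥(maximalRealSubfield L)) L) (IsCMField.complexConj_ne_one L) 𝔫 h𝔫 hφ₀V hφ₀c hφ₀M μK νI h𝓕I h𝓕1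
    (unfoldingBadPlaces L hδ h𝔫) (fun v hv => (hgood_unfoldingBadPlaces L hδ h𝔫 (ξ.bcη⁻¹ * μω) hφ𝔫 v hv).2)
    (finAdelicToAdelic (↥(maximalRealSubfield L)) L (IsCMField.complexConj L) 3 ((StdForm.antidiagonal 3).over L) b₁) hunfK hcδ hδ hd νv μE₁ μF₁
    (unfoldingArchPhase L ξ) (unfoldingArchPhase_norm_le_one L ξ) (unfoldingArchPhase_ne_zero L ξ) kμ hk
    (Complex.ofReal_ne_zero.2 (unfoldingHaarConst_ne_zero L (complexConj_mul_complexConj L) hcδ hδ hd ν h𝓕N μE μE₁ μE₂ μF μF₁ μF₂ νv (isUnitary_bcηInv_mul L ξ hμu) (isUnitary_quadraticHeckeCharCM_mul_self L) (bcηInv_mul_ideleBaseChange_eq L ξ hμω)))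
    hsrc

end Summit.HodgeConjecture.HodgeConjecture.R90.S8

end
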